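import Summits.CriticalPhenomena.PercolationContinuityZ3.Theorems.Transplant.KNLevelsStepIV
import Summits.CriticalPhenomena.PercolationContinuityZ3.Theorems.Transplant.KNLevelsTargetChainEdge
import HarnessLib

/-!
# Kozma–Nitzan's Lemma 11 in the KIT framework (generic): a LINK THROUGH A REGION from a chain of target steps — `P_W(S ↔ T inside Q) > 1 - ε`
# as soon as a chain of target steps under `W` restricted to `Q`, with source a vertex of `S` inside its first level and last true target in `T`,
# has kits (the elongated deep routes `h3` of p3-g2's `kitClause` for aspect-`2K` prisms; design HOME/prim-bschramm-p2-g2/F8-DESIGN.md §9)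

builds on p205010 (kernel theorem, internal audit signed; external expert review pending) — nothing in this file uses p205010.
Lane `prim-bschramm`, seat `prim-bschramm-p2` (Corridor-over-levels); helper file (`--supports stmt-CriticalPhenomena-4575`).

KN prove the hittability of elongated boxes (Lemma 11) by a chain of `K` applications of Lemma 10 inside the box with the cube wired; the
source of such a chain has probability one, so the chain's accuracy costs nothing and `K` enters only through the scales.  Here:
* `real_reachB_eq_one` — if `o ∈ X_0(0)` then `P_W(o ↔ X_0(0)) = 1`;
* **`linkIn_of_chain`** — `TargetProperty.chain_edge`'s conclusion for `G'` + a chain under `restrW Q W` with source `o ∈ S ∩ X_0(0)`, `o ∈ Q`,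
  last true target `⊆ T` ⟹ `1 - ε < P_W(linkIn Q S T)`.
[cite: KozmaNitzan2024, §4 Lemma 11 (pp. 22–23), p. 16 (hittable)] [cite: GrimmettPercolation1999, §7.2]
-/

noncomputable section

open MeasureTheory ProbabilityTheory
open scoped ENNReal Classical

namespace Summit.CriticalPhenomena.PercolationContinuityZ3.Theorems

namespace Transplant

namespace KNLevels

open Literature.Probability.Percolation Literature.Probability.LatticeModels SimpleGraph

variable {V : Type*} [DecidableEq V] [Countable V]

omit [DecidableEq V] [Countable V] in
/-- If the source lies in the first level, it is reached with probability one. [folklore] -/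
theorem real_reachB_eq_one {G : SimpleGraph V} (W : Sym2 V → unitInterval) (L : LData G) (ho : L.o ∈ L.X 0) :
    (prodBernoulli W).real L.reachB = 1 := by
  have : L.reachB = Set.univ := by
    refine Set.eq_univ_of_forall fun ω => ?_
    rw [LData.reachB]
    exact Set.mem_biUnion (Finset.mem_coe.2 ho) (SimpleGraph.Reachable.refl _)
  rw [this, probReal_univ]

/-- **LEMMA 11 IN THE KIT FRAMEWORK: a link through `Q` from a chain of target steps.**  Let the chain property at `(ε, n)` hold with
accuracy `δ > 0` for `G'`; a chain `s₀, …, s_n` over `G'` under `restrW Q W` with common source `o ∈ S`, `o ∈ Q`, `o ∈ X_0(0)`, true targets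
`T'_i ⊆ T_i` linked into the next cores, kits at `δ`, excess `≤ η ≤ δ/2`, and `T'_n ⊆ T` gives `1 - ε < P_W(S ↔ T inside Q)`.
[cite: KozmaNitzan2024, §4 Lemma 11 (pp. 22–23)] -/
theorem linkIn_of_chain {G' : SimpleGraph V} [G'.LocallyFinite] {p : unitInterval} {Δ' : ℕ} {δ ε η : ℝ} {n : ℕ} (hδ0 : 0 < δ)
    (hchain : ∀ (W : Sym2 V → unitInterval) (s : Fin (n + 1) → TStep G') (T' : Fin (n + 1) → Finset V) (η : ℝ),
      (∀ i : Fin (n + 1), (s i).L.o = (s 0).L.o) →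
      (∀ i : Fin n, T' (Fin.castSucc i) ⊆ (s i.succ).L.X 0) →
      (∀ i : Fin (n + 1), T' i ⊆ (s i).T) →
      (∀ i : Fin (n + 1), (s i).KitsAt W p Δ' δ) →
      η ≤ δ / 2 →
      (∀ i : Fin (n + 1), (prodBernoulli W).real (⋃ t ∈ (s i).T \ T' i, openConn (s 0).L.o t) ≤ η) →
      1 - δ < (prodBernoulli W).real (s 0).L.reachB →
        1 - ε < (prodBernoulli W).real (⋃ t ∈ T' (Fin.last n), openConn (s 0).L.o t))
    (W : Sym2 V → unitInterval) {Q S T : Finset V} {o : V} (hoS : o ∈ S) (hoQ : o ∈ Q)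
    (s : Fin (n + 1) → TStep G') (T' : Fin (n + 1) → Finset V) (ho : ∀ i : Fin (n + 1), (s i).L.o = o)
    (ho0 : o ∈ (s 0).L.X 0)
    (hlink : ∀ i : Fin n, T' (Fin.castSucc i) ⊆ (s i.succ).L.X 0) (hsub : ∀ i : Fin (n + 1), T' i ⊆ (s i).T)
    (hkits : ∀ i : Fin (n + 1), (s i).KitsAt (restrW (↑Q : Set V) W) p Δ' δ) (hη : η ≤ δ / 2)
    (hexc : ∀ i : Fin (n + 1), (prodBernoulli (restrW (↑Q : Set V) W)).real (⋃ t ∈ (s i).T \ T' i, openConn o t) ≤ η)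
    (hTn : T' (Fin.last n) ⊆ T) :
    1 - ε < (prodBernoulli W).real (linkIn (↑Q : Set V) S T) := by
  have ho' : ∀ i : Fin (n + 1), (s i).L.o = (s 0).L.o := fun i => by rw [ho i, ho 0]
  have hsrc : 1 - δ < (prodBernoulli (restrW (↑Q : Set V) W)).real (s 0).L.reachB := by
    rw [real_reachB_eq_one _ _ (by rw [ho 0]; exact ho0)]; linarith
  have hexc' : ∀ i : Fin (n + 1), (prodBernoulli (restrW (↑Q : Set V) W)).real
      (⋃ t ∈ (s i).T \ T' i, openConn (s 0).L.o t) ≤ η := fun i => by rw [ho 0]; exact hexc i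
  have hc := hchain _ s T' η ho' hlink hsub hkits hη hexc' hsrc
  rw [ho 0, ← Finset.set_biUnion_coe, prodBernoulli_restrW_real_biUnion_openConn _ _ (Finset.mem_coe.2 hoQ)] at hc
  refine hc.trans_le (measureReal_mono ?_ (measure_ne_top _ _))
  intro ω hω
  simp only [Set.mem_iUnion, exists_prop, Finset.mem_coe] at hω
  obtain ⟨t, ht, hωt⟩ := hω
  exact ⟨o, hoS, t, hTn ht, hωt⟩

end KNLevels

end Transplant

end Summit.CriticalPhenomena.PercolationContinuityZ3.Theorems

end
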